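import Summits.CriticalPhenomena.CardyFormulaZ2.Theorems.CardyIKTransportIKLinearTransportFarRSWOfInputsPrep

/-!
# Stub `stub_OneArmDecay` (crux stmt-CriticalPhenomena-5076 `CardyIKTransport.IKLinearTransport`, line
# `pinned-diagram-exchange`) — part 1 of 2: annular witnesses and the level events

Theorem-only support file (`--supports stmt-CriticalPhenomena-5076`, registered sub-goal
`oad_arm_subset_level`) for the skeleton stub `stub_OneArmDecay` (skeleton v15: polynomial ONE-ARM DECAY of
colour `bb` from the ring family of colour `bb`, uniformly in the column pattern). The proof (part 2) peels
nested squares `box_m = [a-m, a+n+m)²` around the `n × n` box at `(a, b)`, each conditioned at distance its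
side `n + 2m`; this file supplies the deterministic geometry:

* `oad_cut_first`, `oad_annular_witness` — list surgery in a simple graph: a chain through a "box" cell and a
  "far" cell contains a sub-chain from a box cell to a far cell avoiding the INTERIOR of the box and staying
  near it (walk back from the first far cell to the last visit of the box before it; neighbours of interior
  cells lie in the box);
* the LEVEL EVENT of level `m` ("some colour-`bb` path, all of whose cells lie within sup-distance
  `n + 2m + 1` of `box_m` and off its interior `[a-m+1, a+n+m-1)²`, meets `box_m` and reaches
  `farFrom box_m (n+2m)`"): it is read on any set containing its cells and the faces below them
  (`oad_level_mem_determinedOn`, by `Lift.monoPaths_congr`), hence measurable (`oad_level_measurableSet`)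
  and determined far from every level `m'` with `3m' + n + 2 ≤ m` (`oad_level_mem_determinedOn_far`); it is
  disjoint from the confinement event of its level (`oad_level_not_conf`); and the ARM EVENT "some
  colour-`bb` path joins the `n × n` box to `farFrom a b n n R`" lies in it whenever `3m + n ≤ R`
  (`oad_arm_subset_level`, registered).

No definitions (the level event is written out), no literature facts.
-/

noncomputable section

namespace Summit.CriticalPhenomena.CardyFormulaZ2.Theorems.IKLinearTransport.PinnedDiagramExchange

open scoped BigOperators Topology Classical MeasureTheory ProbabilityTheory ENNReal symmDiff
open Filter Set Function MeasureTheory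
open Literature.Probability.Percolation Literature.Probability.LatticeModels
open Literature.Probability.RandomPlanarGeometry

/-! ## §1 List surgery -/

/-- CUT AT THE FIRST `P`-CELL: a chain from a non-`P` cell `c` containing a `P`-cell later has an initial
segment `c :: (q ++ [t])` whose cells `c :: q` are not `P` and whose last cell `t` is `P`. [folklore] -/
theorem oad_cut_first {α : Type*} {R : α → α → Prop} {P : α → Prop} (rest : List α) :
    ∀ c : α, List.IsChain R (c :: rest) → ¬ P c → (∃ v ∈ rest, P v) →
      ∃ (q : List α) (t : α), List.IsChain R (c :: (q ++ [t])) ∧ (∀ z ∈ q ++ [t], z ∈ rest) ∧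
        (∀ z ∈ c :: q, ¬ P z) ∧ P t := by
  induction rest with
  | nil =>
    rintro c - - ⟨v, hv, -⟩
    exact absurd hv List.not_mem_nil
  | cons c' rest' ih =>
    rintro c hchain hc ⟨v, hv, hvP⟩
    obtain ⟨hcc', hrest⟩ := List.isChain_cons_cons.1 hchain
    by_cases hc'P : P c'
    · refine ⟨[], c', List.isChain_cons_cons.2 ⟨hcc', List.isChain_singleton c'⟩, fun z hz => ?_,
        fun z hz => ?_, hc'P⟩
      · rw [List.nil_append, List.mem_singleton] at hz
        subst hz
        exact List.mem_cons_self
      · rw [List.mem_singleton] at hz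
        subst hz
        exact hc
    · have hv' : v ∈ rest' := by
        rcases List.mem_cons.1 hv with rfl | hv
        · exact absurd hvP hc'P
        · exact hv
      obtain ⟨q', t, hq'c, hq'sub, hq'P, htP⟩ := ih c' hrest hc'P ⟨v, hv', hvP⟩
      refine ⟨c' :: q', t, List.isChain_cons_cons.2 ⟨hcc', hq'c⟩, fun z hz => ?_, fun z hz => ?_, htP⟩
      · rcases List.mem_cons.1 hz with rfl | hz
        · exact List.mem_cons_self
        · exact List.mem_cons_of_mem _ (hq'sub z hz)
      · rcases List.mem_cons.1 hz with rfl | hz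
        · exact hc
        · exact hq'P z hz

/-- In a chain `l ++ [t]` with `l ≠ []`, some cell of `l` (its last) is related to `t`. [folklore] -/
theorem oad_exists_rel_last {α : Type*} {R : α → α → Prop} (t : α) :
    ∀ l : List α, l ≠ [] → List.IsChain R (l ++ [t]) → ∃ z ∈ l, R z t
  | [], h, _ => absurd rfl h
  | [x], _, h => ⟨x, List.mem_singleton_self x, (List.isChain_cons_cons.1 h).1⟩
  | x :: y :: l', _, h => by
    obtain ⟨z, hz, hzt⟩ :=
      oad_exists_rel_last t (y :: l') (List.cons_ne_nil _ _) (List.isChain_cons_cons.1 h).2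
    exact ⟨z, List.mem_cons_of_mem _ hz, hzt⟩

/-- ANNULAR WITNESSES. In a simple graph with a "box" `B`, its "interior" `I` (contained in `B`, and whose
neighbours lie in `B`), a "far" region `F` disjoint from `B` and a "near" region `N'` containing the non-far
cells and their neighbours: a chain through a `B`-cell and a far cell contains a sub-chain through a `B`-cell
and a far cell all of whose cells are near and NOT interior (walk back from the first far cell to the last
visit of `B` before it). [folklore] -/
theorem oad_annular_witness {α : Type*} (G : SimpleGraph α) {B I F N' : α → Prop}
    (hIB : ∀ u v, G.Adj u v → I u → B v) (hIB' : ∀ u, I u → B u) (hBF : ∀ u, B u → ¬ F u)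
    (hN : ∀ u, ¬ F u → N' u) (hRN : ∀ u v, G.Adj u v → ¬ F u → N' v)
    {l : List α} (hl : List.IsChain G.Adj l) {u : α} (hu : u ∈ l) (huB : B u) {v : α} (hv : v ∈ l)
    (hvF : F v) :
    ∃ q : List α, q ≠ [] ∧ List.IsChain G.Adj q ∧ (∀ z ∈ q, z ∈ l) ∧ (∀ z ∈ q, N' z ∧ ¬ I z) ∧
      (∃ u ∈ q, B u) ∧ ∃ v ∈ q, F v := by
  -- step 0: a chain `u :: rest` inside `l` with a far cell in `rest`
  obtain ⟨rest, hchain, hsub, hfar⟩ : ∃ rest : List α, List.IsChain G.Adj (u :: rest) ∧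
      (∀ z ∈ rest, z ∈ l) ∧ ∃ v ∈ rest, F v := by
    obtain ⟨s, t, rfl⟩ := List.append_of_mem hu
    obtain ⟨hleft, hright⟩ := List.isChain_split.1 hl
    have hvu : v ≠ u := fun h => hBF u huB (h ▸ hvF)
    rcases List.mem_append.1 hv with hvs | hvt
    · have hrev : List.IsChain G.Adj (u :: s.reverse) := by
        have h1 : (s ++ [u]).reverse = u :: s.reverse := by simp
        rw [← h1, List.isChain_reverse]
        exact hleft.imp fun a b h => h.symm
      exact ⟨s.reverse, hrev, fun z hz => List.mem_append_left _ (List.mem_reverse.1 hz),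
        v, List.mem_reverse.2 hvs, hvF⟩
    · have hvt' : v ∈ t := by
        rcases List.mem_cons.1 hvt with h | h
        · exact absurd h hvu
        · exact h
      exact ⟨t, hright, fun z hz => List.mem_append_right _ (List.mem_cons_of_mem _ hz), v, hvt', hvF⟩
  -- step 1: cut at the first far cell
  obtain ⟨q₁, t₁, hc₁, hsub₁, hnf₁, ht₁F⟩ := oad_cut_first rest u hchain (hBF u huB) hfar
  have ht₁N : N' t₁ := by
    obtain ⟨z, hz, hzt⟩ := oad_exists_rel_last t₁ (u :: q₁) (List.cons_ne_nil _ _) hc₁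
    exact hRN z t₁ hzt (hnf₁ z hz)
  -- step 2: read it backwards, from the far cell `t₁`
  have hrev : List.IsChain G.Adj (t₁ :: (q₁.reverse ++ [u])) := by
    have h1 : (u :: (q₁ ++ [t₁])).reverse = t₁ :: (q₁.reverse ++ [u]) := by simp
    rw [← h1, List.isChain_reverse]
    exact hc₁.imp fun a b h => h.symm
  have hmem₂ : ∀ z ∈ q₁.reverse ++ [u], z ∈ u :: q₁ := by
    intro z hz
    rcases List.mem_append.1 hz with hz | hz
    · exact List.mem_cons_of_mem _ (List.mem_reverse.1 hz)
    · rw [List.mem_singleton] at hz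
      subst hz
      exact List.mem_cons_self
  -- step 3: cut at the first box cell
  obtain ⟨q₂, t₂, hc₂, hsub₂, hnb₂, ht₂B⟩ := oad_cut_first (P := B) (q₁.reverse ++ [u]) t₁ hrev
    (fun h => hBF t₁ h ht₁F) ⟨u, List.mem_append_right _ (List.mem_singleton_self u), huB⟩
  have ht₂I : ¬ I t₂ := by
    obtain ⟨z, hz, hzt⟩ := oad_exists_rel_last t₂ (t₁ :: q₂) (List.cons_ne_nil _ _) hc₂
    exact fun h => hnb₂ z hz (hIB t₂ z hzt.symm h)
  -- step 4: the witness `t₁ :: (q₂ ++ [t₂])`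
  have hl₁ : ∀ z ∈ u :: q₁, z ∈ l := by
    intro z hz
    rcases List.mem_cons.1 hz with rfl | hz
    · exact hu
    · exact hsub z (hsub₁ z (List.mem_append_left _ hz))
  refine ⟨t₁ :: (q₂ ++ [t₂]), List.cons_ne_nil _ _, hc₂, fun z hz => ?_, fun z hz => ?_,
    ⟨t₂, List.mem_cons_of_mem _ (List.mem_append_right _ (List.mem_singleton_self t₂)), ht₂B⟩,
    t₁, List.mem_cons_self, ht₁F⟩
  · rcases List.mem_cons.1 hz with rfl | hz
    · exact hsub _ (hsub₁ _ (List.mem_append_right _ (List.mem_singleton_self _)))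
    · exact hl₁ z (hmem₂ z (hsub₂ z hz))
  · rcases List.mem_cons.1 hz with rfl | hz
    · exact ⟨ht₁N, fun h => hBF _ (hIB' _ h) ht₁F⟩
    · have hz' : z ∈ u :: q₁ := hmem₂ z (hsub₂ z hz)
      refine ⟨hN z (hnf₁ z hz'), fun h => ?_⟩
      rcases List.mem_append.1 hz with hzq | hzt
      · exact hnb₂ z (List.mem_cons_of_mem _ hzq) (hIB' z h)
      · rw [List.mem_singleton] at hzt
        subst hzt
        exact ht₂I h

/-! ## §2 The level events

Level `m` of the nested-square scheme around the `n × n` box at `(a, b)`: the square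
`box_m = [a-m, a+n+m)²` of side `n + 2m`, conditioning distance `n + 2m`; its LEVEL EVENT is "some
colour-`bb` path, all of whose cells lie within sup-distance `n + 2m + 1` of `box_m` and off the interior
`[a-m+1, a+n+m-1)²`, meets `box_m` and reaches `farFrom box_m (n + 2m)`". -/

/-- THE LEVEL EVENT IS READ ON ANY SET CONTAINING ITS CELLS AND THE FACES BELOW THEM. [folklore] -/
theorem oad_level_mem_determinedOn (bb : Bool) (a b : ℤ) (n m : ℕ) {Λ : Set (Site 2)}
    (hΛ : ∀ z : Site 2, (a - n - 3 * m - 1 ≤ z 0 ∧ z 0 ≤ a + 2 * n + 3 * m ∧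
        b - n - 3 * m - 1 ≤ z 1 ∧ z 1 ≤ b + 2 * n + 3 * m) ∧
      ¬ (a - m + 1 ≤ z 0 ∧ z 0 < a + n + m - 1 ∧ b - m + 1 ≤ z 1 ∧ z 1 < b + n + m - 1) →
      z ∈ Λ ∧ z + ![0, -1] ∈ Λ) :
    {x : Obs | ∃ p ∈ monoPaths x bb,
      (∀ z ∈ p, (a - n - 3 * m - 1 ≤ z 0 ∧ z 0 ≤ a + 2 * n + 3 * m ∧
          b - n - 3 * m - 1 ≤ z 1 ∧ z 1 ≤ b + 2 * n + 3 * m) ∧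
        ¬ (a - m + 1 ≤ z 0 ∧ z 0 < a + n + m - 1 ∧ b - m + 1 ≤ z 1 ∧ z 1 < b + n + m - 1)) ∧
      (∃ u ∈ p, a - m ≤ u 0 ∧ u 0 < a + n + m ∧ b - m ≤ u 1 ∧ u 1 < b + n + m) ∧
      ∃ v ∈ p, v ∈ farFrom (a - m) (b - m) (n + 2 * m) (n + 2 * m) (n + 2 * m)} ∈ determinedOn Λ := by
  intro x y hxy
  have hxy' : Lift.Agree Λ x y := hxy
  constructor
  · rintro ⟨p, hp, hcells, hB, hF⟩
    exact ⟨p, Lift.monoPaths_congr hxy' (fun z hz => hΛ z (hcells z hz)) hp, hcells, hB, hF⟩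
  · rintro ⟨p, hp, hcells, hB, hF⟩
    exact ⟨p, Lift.monoPaths_congr hxy'.symm (fun z hz => hΛ z (hcells z hz)) hp, hcells, hB, hF⟩

/-- THE LEVEL EVENT IS MEASURABLE (it is determined by a finite box). [folklore] -/
theorem oad_level_measurableSet (bb : Bool) (a b : ℤ) (n m : ℕ) :
    MeasurableSet {x : Obs | ∃ p ∈ monoPaths x bb,
      (∀ z ∈ p, (a - n - 3 * m - 1 ≤ z 0 ∧ z 0 ≤ a + 2 * n + 3 * m ∧
          b - n - 3 * m - 1 ≤ z 1 ∧ z 1 ≤ b + 2 * n + 3 * m) ∧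
        ¬ (a - m + 1 ≤ z 0 ∧ z 0 < a + n + m - 1 ∧ b - m + 1 ≤ z 1 ∧ z 1 < b + n + m - 1)) ∧
      (∃ u ∈ p, a - m ≤ u 0 ∧ u 0 < a + n + m ∧ b - m ≤ u 1 ∧ u 1 < b + n + m) ∧
      ∃ v ∈ p, v ∈ farFrom (a - m) (b - m) (n + 2 * m) (n + 2 * m) (n + 2 * m)} :=
  frsw_measurableSet_of_determinedOn_box (a - n - 3 * m - 2) (b - n - 3 * m - 2) (3 * n + 6 * m + 4)
    (3 * n + 6 * m + 4) (oad_level_mem_determinedOn bb a b n m fun z hz => by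
      simp only [Set.mem_setOf_eq, Pi.add_apply, Matrix.cons_val_zero, Matrix.cons_val_one,
        Matrix.cons_val_fin_one]
      push_cast
      omega)

/-- THE LEVEL EVENT OF LEVEL `m'` IS DETERMINED FAR FROM LEVEL `m` as soon as `3m + n + 2 ≤ m'`. [folklore] -/
theorem oad_level_mem_determinedOn_far (bb : Bool) (a b : ℤ) (n m m' : ℕ) (hmm' : 3 * m + n + 2 ≤ m') :
    {x : Obs | ∃ p ∈ monoPaths x bb,
      (∀ z ∈ p, (a - n - 3 * m' - 1 ≤ z 0 ∧ z 0 ≤ a + 2 * n + 3 * m' ∧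
          b - n - 3 * m' - 1 ≤ z 1 ∧ z 1 ≤ b + 2 * n + 3 * m') ∧
        ¬ (a - m' + 1 ≤ z 0 ∧ z 0 < a + n + m' - 1 ∧ b - m' + 1 ≤ z 1 ∧ z 1 < b + n + m' - 1)) ∧
      (∃ u ∈ p, a - m' ≤ u 0 ∧ u 0 < a + n + m' ∧ b - m' ≤ u 1 ∧ u 1 < b + n + m') ∧
      ∃ v ∈ p, v ∈ farFrom (a - m') (b - m') (n + 2 * m') (n + 2 * m') (n + 2 * m')} ∈
      determinedOn (farFrom (a - m) (b - m) (n + 2 * m) (n + 2 * m) (n + 2 * m)) :=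
  oad_level_mem_determinedOn bb a b n m' fun z hz => by
    simp only [farFrom, Set.mem_setOf_eq, Pi.add_apply, Matrix.cons_val_zero, Matrix.cons_val_one,
      Matrix.cons_val_fin_one]
    push_cast
    omega

/-- THE LEVEL EVENT IS DISJOINT FROM THE CONFINEMENT EVENT of its level (the conclusion event of the ring
family for the box `box_m` at distance `n + 2m`). [folklore] -/
theorem oad_level_not_conf (bb : Bool) (a b : ℤ) (n m : ℕ) (x : Obs)
    (hx : x ∈ {x : Obs | ∃ p ∈ monoPaths x bb,
      (∀ z ∈ p, (a - n - 3 * m - 1 ≤ z 0 ∧ z 0 ≤ a + 2 * n + 3 * m ∧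
          b - n - 3 * m - 1 ≤ z 1 ∧ z 1 ≤ b + 2 * n + 3 * m) ∧
        ¬ (a - m + 1 ≤ z 0 ∧ z 0 < a + n + m - 1 ∧ b - m + 1 ≤ z 1 ∧ z 1 < b + n + m - 1)) ∧
      (∃ u ∈ p, a - m ≤ u 0 ∧ u 0 < a + n + m ∧ b - m ≤ u 1 ∧ u 1 < b + n + m) ∧
      ∃ v ∈ p, v ∈ farFrom (a - m) (b - m) (n + 2 * m) (n + 2 * m) (n + 2 * m)}) :
    x ∉ {x : Obs | ∀ p ∈ monoPaths x bb,
        (∃ u ∈ p, a - m ≤ u 0 ∧ u 0 < a - m + (n + 2 * m : ℕ) ∧ b - m ≤ u 1 ∧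
          u 1 < b - m + (n + 2 * m : ℕ)) →
        ∀ v ∈ p, v ∉ farFrom (a - m) (b - m) (n + 2 * m) (n + 2 * m) (n + 2 * m)} := by
  obtain ⟨p, hp, -, ⟨u, hu, huB⟩, v, hv, hvF⟩ := hx
  exact fun h => h p hp ⟨u, hu, by push_cast; omega⟩ v hv hvF

/-- **THE ARM EVENT IMPLIES EVERY LEVEL EVENT IT REACHES ACROSS** (registered sub-goal `oad_arm_subset_level`
of `stub_OneArmDecay`): a colour-`bb` path from the `n × n` box at `(a, b)` to `farFrom a b n n R` contains an
annular witness of level `m` (see the section docstring) whenever `3m + n ≤ R`. [folklore] -/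
theorem oad_arm_subset_level : ∀ (bb : Bool) (a b : ℤ) (n m R : ℕ), 3 * m + n ≤ R → ∀ x : Obs,
    (∃ p ∈ monoPaths x bb, (∃ u ∈ p, a ≤ u 0 ∧ u 0 < a + n ∧ b ≤ u 1 ∧ u 1 < b + n) ∧
      ∃ v ∈ p, v ∈ farFrom a b n n R) →
    x ∈ {x : Obs | ∃ p ∈ monoPaths x bb,
      (∀ z ∈ p, (a - n - 3 * m - 1 ≤ z 0 ∧ z 0 ≤ a + 2 * n + 3 * m ∧
          b - n - 3 * m - 1 ≤ z 1 ∧ z 1 ≤ b + 2 * n + 3 * m) ∧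
        ¬ (a - m + 1 ≤ z 0 ∧ z 0 < a + n + m - 1 ∧ b - m + 1 ≤ z 1 ∧ z 1 < b + n + m - 1)) ∧
      (∃ u ∈ p, a - m ≤ u 0 ∧ u 0 < a + n + m ∧ b - m ≤ u 1 ∧ u 1 < b + n + m) ∧
      ∃ v ∈ p, v ∈ farFrom (a - m) (b - m) (n + 2 * m) (n + 2 * m) (n + 2 * m)} := by
  intro bb a b n m R hR x hx
  obtain ⟨p, hp, ⟨u, hu, huB⟩, v, hv, hvF⟩ := hx
  obtain ⟨q, hqne, hqc, hqsub, hqN, hqB, hqF⟩ := oad_annular_witness (cellGraph x.2)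
    (B := fun z : Site 2 => a - m ≤ z 0 ∧ z 0 < a + n + m ∧ b - m ≤ z 1 ∧ z 1 < b + n + m)
    (I := fun z : Site 2 => a - m + 1 ≤ z 0 ∧ z 0 < a + n + m - 1 ∧ b - m + 1 ≤ z 1 ∧ z 1 < b + n + m - 1)
    (F := fun z : Site 2 => z ∈ farFrom (a - m) (b - m) (n + 2 * m) (n + 2 * m) (n + 2 * m))
    (N' := fun z : Site 2 => a - n - 3 * m - 1 ≤ z 0 ∧ z 0 ≤ a + 2 * n + 3 * m ∧
      b - n - 3 * m - 1 ≤ z 1 ∧ z 1 ≤ b + 2 * n + 3 * m)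
    (fun z z' hzz' hz => by
      have hc := frsw_cellGraph_adj_coord hzz'
      omega)
    (fun z hz => by omega)
    (fun z hz hzF => by
      simp only [farFrom, Set.mem_setOf_eq] at hzF
      push_cast at hzF
      omega)
    (fun z hz => by
      simp only [farFrom, Set.mem_setOf_eq] at hz
      push_cast at hz
      omega)
    (fun z z' hzz' hz => by
      have hc := frsw_cellGraph_adj_coord hzz'
      simp only [farFrom, Set.mem_setOf_eq] at hz
      push_cast at hz
      omega)
    hp.2.1 hu (by omega) hv (by
      simp only [farFrom, Set.mem_setOf_eq] at hvF ⊢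
      push_cast at hvF ⊢
      omega)
  exact ⟨q, ⟨hqne, hqc, fun z hz => hp.2.2 z (hqsub z hz)⟩, hqN, hqB, hqF⟩

end Summit.CriticalPhenomena.CardyFormulaZ2.Theorems.IKLinearTransport.PinnedDiagramExchange

end
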